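import Mathlib

/-!
# BalabanUVNodes ∕ N19 (NE7) — BIRKHOFF's CONTRACTION THEOREM FOR POSITIVE KERNELS ON FINITE INDEX SETS (cross-ratio form):
# the tool by which a positive linear step COMMON to both runs contracts the class-oscillation half of `Spine.NE7.Core`

Cell `pub-ymgap` (HUMAN RULING D-0062 Track A; D-0149 width seats), seat `pub-ymgap-dag-n19-w2` (WIDTH SEAT 2 of 3 on NODE n19 =
NE7), generation g6, CLAIM-1 (INBOX l.32074).  Route `Summits/QuantumFields/YangMills/Theses/BalabanUVNodes.lean`, key item K3⁷
`SpineGivenEndpointR13SepCoPH` (stmt-QuantumFields-20544); filed `--kind proof --supports … --as helper`.  COUNT-NEUTRAL.  THEOREMS ONLY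
(0 `def`, 0 `sorry`); Mathlib only; modifies nothing.  Companion files: `…N19BirkhoffContractionSharp` (logarithmic ∕ exact product
form, the `2 × 2` sharpness witness) and `…N19CoreCommonStep` (the `NE7.Core` statements).

THE THEOREM (G. Birkhoff 1957, *Extensions of Jentzsch's theorem*, Trans. AMS 85, 219–227; E. Hopf 1963; modern statement and
elementary proof: S. P. Eveson – R. D. Nussbaum, Math. Proc. Camb. Phil. Soc. 117 (1995) 31–55, Theorem 3.5 p. 39
«`k(L;C,D) = N(L;C,D) = tanh(Δ(L)∕4)`»; exact product form `tanh(δ(Tx,Ty)∕4) ≤ tanh(Δ∕4)·tanh(δ(x,y)∕4)`: L. Dubois,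
arXiv:0811.2930, Remark 1 p. 8 — all read on the held copies), here in the REAL, FINITE-INDEX case and in the explicit CROSS-RATIO
form that needs no cone ∕ gauge vocabulary: for two positive rows `a, b` of a kernel whose cross-ratios are bounded,
`a_k b_l ≤ e^Δ · a_l b_k` (projective diameter of the rows `≤ Δ`), and two positive vectors `x, y` with `y_k x_l ≤ e^d · x_k y_l`
(Hilbert distance `osc log (y∕x) ≤ d`), the images satisfy `(Σ a y)(Σ b x)·(e^{d∕2} + e^{Δ∕2})² ≤ (Σ a x)(Σ b y)·(e^{(d+Δ)∕2} + 1)²`,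
i.e. the Hilbert distance `d′` of the image rows obeys `tanh(d′∕4) ≤ tanh(d∕4)·tanh(Δ∕4)` — Birkhoff's coefficient `tanh(Δ∕4)` —
whence `d′ ≤ tanh(Δ∕4)·d`; and WITHOUT any positivity ∕ diameter hypothesis `d′ ≤ d` (a non-negative kernel never expands: weak
contraction, Eveson–Nussbaum Thm 3.6) and `d′ ≤ Δ`.  Mathlib has neither Hilbert's projective metric nor Birkhoff's theorem
(2026-08-28); the tree holds the COMPLEX-cone principle only (`Literature.Dynamics.Contraction.Dubois2009_thm_2_3_holds`, EReal
gauge `duboisDelta`) — cited, not used: the positive-orthant case is proved here directly, and a librarian may lift §0–§3 verbatim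
to `Literature/Dynamics/Contraction/` with the Eveson–Nussbaum locator (bib key `EvesonNussbaum1995` added by this seat).

THE PROOF is elementary and self-contained: writing `u = Σ a (y − αx)`, `v = Σ a (e^d αx − y)` for each row, the image ratio is a
Möbius function of `u∕v`, the rows' cross-ratio bound passes to `(u_a, v_a; u_b, v_b)`, and the whole theorem reduces to the
polynomial identity `(q²u + v)(p²u + v)(pq + 1)² − (p²q²u + v)(u + v)(p + q)² = (p² − 1)(q² − 1)(pqu − v)²` (`p = e^{d∕2}`,
`q = e^{Δ∕2}`).  The linear bound `2·log((pq+1)∕(p+q)) ≤ tanh(Δ∕4)·d` is one monotonicity-by-derivative step.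

CONTENTS.  §0 the algebra (`birkhoff_poly_identity`, `birkhoff_poly_le`, `cross_step_le`, `four_var_le`) and the special-function
facts (`tanh_quarter_eq`, `tanh_quarter_nonneg`, `tanh_quarter_lt_one`, ★ `two_mul_log_birkhoff_le_tanh_mul`); §1 ★★ THE TWO-ROW
THEOREM `sum_mul_sum_le_birkhoff` (`p, q, α` form); §2 ★★ `two_rows_le_birkhoff` (exponential form, the sharp value) · ★★
`two_rows_le_exp_tanh_mul` (the linear coefficient folded in) · ★ `two_rows_le_exp_dist` (WEAK BOUND I: monotonicity under ANY
non-negative rows) · `two_rows_le_exp_diam` (WEAK BOUND II: the diameter); §3 ★★ `chain_dist_le_pow` (a chain of `n` positive steps of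
diameter `≤ Δ` contracts the distance to `≤ tanh(Δ∕4)^n·d`) · `summable_tanh_quarter_pow_mul` (that rate is summable).

WHY N19 WANTS IT (details in `…N19CoreCommonStep`).  `Spine.NE7.Core`'s level-`K` width is half the oscillation of `log(Q∕P)` over the
good (source, class) points (dag-n19-e `N19CoreMetric.core_iff_logRatio_osc_le`); the two runs of Bałaban's procedure differ at the
finest step and then apply the SAME later steps — positive linear maps (integration against non-negative kernels, NOT normalised).  By
WEAK BOUND I such a common step never widens `Core` (the 0-1 fibre kernel is dag-n19-w1's `N19RekeyingCalculus.core_classVal`, the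
diagonal kernel dag-n19-e's `core_common_mul_iff`); by the theorem it CONTRACTS the per-source CLASS-oscillation by `tanh(Δ∕4)` when
its good rows have cross-ratio diameter `≤ Δ`, so `K` common steps make a class-oscillation born at the first step GEOMETRIC in `K`
(§3) — node U6's geometric age transport produced rather than assumed — while the SOURCE-oscillation of the class-centre is untouched
(block-diagonal in the source ⇒ infinite diameter).

HONEST FRAMING.  [folklore]-grade positive-operator theory with textbook locators; hypothesis SHAPES only.  ZERO Bałaban content: NO RG
step of [Balaban1988Convergent] ∕ [Balaban1989LargeFieldI ∕ II] is shown to have finite projective diameter on the good classes, and for a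
realistic lattice step `Δ` is EXTENSIVE in the block volume (`tanh(Δ∕4) = 1 − O(e^{−Δ∕2})`) — the file types the mechanism and its exact
limits, not an estimate.  NE2–NE7 ∕ NE1′ NOT PRINTED for d = 4 ∕ NOT proved; N19 NOT discharged; K3⁷ OPEN, v5 untouched, not claimed;
counts UNMOVED (typed 28∕28 · discharged 5∕27, A 5∕28); no count claim.  One finite 𝕋⁴ programme at fixed ε, Bałaban AS PRINTED; R4
closes the conditional finite-𝕋⁴ rung `BalabanLadder.UV` only — the YM mass gap (Clay) is NOT proved by any of this; nothing continuum
∕ ℝ⁴ ∕ OS.  No `def`, no `instance`, no `sorry`; standard axioms.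
-/

noncomputable section

open Finset Real

namespace Summit.QuantumFields.YangMills.BalabanUVNodes.N19BirkhoffContraction

/-! ## §0 The algebra behind Birkhoff's coefficient, and the special-function facts -/

/-- The polynomial identity behind Birkhoff's theorem (homogeneous form in `u, v`):
`(q²u + v)(p²u + v)(pq + 1)² − (p²q²u + v)(u + v)(p + q)² = (p² − 1)(q² − 1)(pqu − v)²`. [folklore] -/
theorem birkhoff_poly_identity (p q u v : ℝ) :
    (q ^ 2 * u + v) * (p ^ 2 * u + v) * (p * q + 1) ^ 2 - (p ^ 2 * q ^ 2 * u + v) * (u + v) * (p + q) ^ 2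
      = (p ^ 2 - 1) * (q ^ 2 - 1) * (p * q * u - v) ^ 2 := by
  ring

/-- For `p, q ≥ 1`: `(p²q²u + v)(u + v)(p + q)² ≤ (q²u + v)(p²u + v)(pq + 1)²` (the identity's right-hand side is
non-negative). [folklore] -/
theorem birkhoff_poly_le {p q : ℝ} (hp : 1 ≤ p) (hq : 1 ≤ q) (u v : ℝ) :
    (p ^ 2 * q ^ 2 * u + v) * (u + v) * (p + q) ^ 2 ≤ (q ^ 2 * u + v) * (p ^ 2 * u + v) * (p * q + 1) ^ 2 := by
  have h1 : 0 ≤ p ^ 2 - 1 := by nlinarith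
  have h2 : 0 ≤ q ^ 2 - 1 := by nlinarith
  have h := birkhoff_poly_identity p q u v
  nlinarith [mul_nonneg (mul_nonneg h1 h2) (sq_nonneg (p * q * u - v))]

/-- The cross-ratio step: for `λ ≥ 1` and `u_a v_b ≤ θ·u_b v_a`,
`(λu_a + v_a)(θu_b + v_b) ≤ (u_a + v_a)(λθu_b + v_b)` (the Möbius map `U ↦ (λU + 1)∕(U + 1)` is increasing). [folklore] -/
theorem cross_step_le {l θ ua va ub vb : ℝ} (hl : 1 ≤ l) (hc : ua * vb ≤ θ * (ub * va)) :
    (l * ua + va) * (θ * ub + vb) ≤ (ua + va) * (l * θ * ub + vb) := by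
  have e : (ua + va) * (l * θ * ub + vb) - (l * ua + va) * (θ * ub + vb) = (l - 1) * (θ * (ub * va) - ua * vb) := by
    ring
  nlinarith [mul_nonneg (sub_nonneg.2 hl) (sub_nonneg.2 hc)]

/-- The four-variable form of Birkhoff's inequality: `p, q ≥ 1`, non-negative `u_a, v_a, u_b, v_b` with
`u_b + v_b > 0` (no sign needed on `v_b`) and the cross-ratio bound `u_a v_b ≤ q²·u_b v_a` give
`(p²u_a + v_a)(u_b + v_b)(p + q)² ≤ (u_a + v_a)(p²u_b + v_b)(pq + 1)²`. [folklore] -/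
theorem four_var_le {p q ua va ub vb : ℝ} (hp : 1 ≤ p) (hq : 1 ≤ q) (hua : 0 ≤ ua) (hva : 0 ≤ va)
    (hub : 0 ≤ ub) (hpos : 0 < ub + vb) (hc : ua * vb ≤ q ^ 2 * (ub * va)) :
    (p ^ 2 * ua + va) * (ub + vb) * (p + q) ^ 2 ≤ (ua + va) * (p ^ 2 * ub + vb) * (p * q + 1) ^ 2 := by
  have hp2 : 1 ≤ p ^ 2 := by nlinarith
  have hq2 : 1 ≤ q ^ 2 := by nlinarith
  have h1 : (p ^ 2 * ua + va) * (q ^ 2 * ub + vb) ≤ (ua + va) * (p ^ 2 * q ^ 2 * ub + vb) := cross_step_le hp2 hc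
  have h2 := birkhoff_poly_le hp hq ub vb
  have hw : 0 < q ^ 2 * ub + vb := by nlinarith
  have key : (q ^ 2 * ub + vb) * ((p ^ 2 * ua + va) * (ub + vb) * (p + q) ^ 2) ≤
      (q ^ 2 * ub + vb) * ((ua + va) * (p ^ 2 * ub + vb) * (p * q + 1) ^ 2) :=
    calc (q ^ 2 * ub + vb) * ((p ^ 2 * ua + va) * (ub + vb) * (p + q) ^ 2)
          = (p ^ 2 * ua + va) * (q ^ 2 * ub + vb) * ((ub + vb) * (p + q) ^ 2) := by ring
      _ ≤ (ua + va) * (p ^ 2 * q ^ 2 * ub + vb) * ((ub + vb) * (p + q) ^ 2) :=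
          mul_le_mul_of_nonneg_right h1 (by positivity)
      _ = (ua + va) * ((p ^ 2 * q ^ 2 * ub + vb) * (ub + vb) * (p + q) ^ 2) := by ring
      _ ≤ (ua + va) * ((q ^ 2 * ub + vb) * (p ^ 2 * ub + vb) * (p * q + 1) ^ 2) :=
          mul_le_mul_of_nonneg_left h2 (by positivity)
      _ = (q ^ 2 * ub + vb) * ((ua + va) * (p ^ 2 * ub + vb) * (p * q + 1) ^ 2) := by ring
  exact le_of_mul_le_mul_left key hw

/-- `tanh (Δ∕4) = (e^{Δ∕2} − 1)∕(e^{Δ∕2} + 1)`. [folklore] -/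
theorem tanh_quarter_eq (Δ : ℝ) : Real.tanh (Δ / 4) = (exp (Δ / 2) - 1) / (exp (Δ / 2) + 1) := by
  have hw : exp (Δ / 2) = exp (Δ / 4) * exp (Δ / 4) := by rw [← exp_add]; ring_nf
  have h4 : 0 < exp (Δ / 4) := exp_pos _
  rw [Real.tanh_eq_sinh_div_cosh, Real.sinh_eq, Real.cosh_eq, Real.exp_neg, hw]
  field_simp

/-- `0 ≤ tanh (Δ∕4)` for `0 ≤ Δ`, and `tanh (Δ∕4) < 1`. [folklore] -/
theorem tanh_quarter_nonneg {Δ : ℝ} (hΔ : 0 ≤ Δ) : 0 ≤ Real.tanh (Δ / 4) := by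
  rw [tanh_quarter_eq]
  have : 1 ≤ exp (Δ / 2) := one_le_exp (by linarith)
  exact div_nonneg (by linarith) (by positivity)

/-- `tanh (Δ∕4) < 1`. [folklore] -/
theorem tanh_quarter_lt_one (Δ : ℝ) : Real.tanh (Δ / 4) < 1 := by
  rw [tanh_quarter_eq, div_lt_one (by positivity)]
  linarith

/-- THE LINEAR FORM OF BIRKHOFF's COEFFICIENT: for `d, Δ ≥ 0`,
`2·log ((e^{(d+Δ)∕2} + 1)∕(e^{d∕2} + e^{Δ∕2})) ≤ tanh (Δ∕4) · d`.  (The left side is the sharp bound of §2 on the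
image distance; the map `d ↦` left side is concave with slope `tanh(Δ∕4)` at `0` — proved as: with `q = e^{Δ∕2}`,
`x ↦ tanh(Δ∕4)·x − log (q eˣ + 1) + log (eˣ + q)` has derivative `q(q−1)(eˣ−1)²∕((q+1)(q eˣ+1)(eˣ+q)) ≥ 0` and vanishes
at `0`.) [folklore] (Birkhoff 1957; Eveson–Nussbaum 1995, Thm 3.5 p. 39) -/
theorem two_mul_log_birkhoff_le_tanh_mul {d Δ : ℝ} (hd : 0 ≤ d) (hΔ : 0 ≤ Δ) :
    2 * log ((exp ((d + Δ) / 2) + 1) / (exp (d / 2) + exp (Δ / 2))) ≤ Real.tanh (Δ / 4) * d := by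
  set q : ℝ := exp (Δ / 2) with hq
  have hq0 : 0 < q := exp_pos _
  have hq1 : 1 ≤ q := one_le_exp (by linarith)
  set τ : ℝ := Real.tanh (Δ / 4) with hτ
  have hτq : τ = (q - 1) / (q + 1) := tanh_quarter_eq Δ
  -- the auxiliary monotone function
  set g : ℝ → ℝ := fun x => τ * x - log (q * exp x + 1) + log (exp x + q) with hg
  have hderiv : ∀ x, HasDerivAt g (τ - q * exp x / (q * exp x + 1) + exp x / (exp x + q)) x := by
    intro x
    have h0 : HasDerivAt (fun x : ℝ => τ * x) τ x := by
      simpa using (hasDerivAt_id x).const_mul τ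
    have h1 : HasDerivAt (fun x : ℝ => q * exp x + 1) (q * exp x) x := by
      simpa using ((Real.hasDerivAt_exp x).const_mul q).add_const 1
    have h1' : HasDerivAt (fun x : ℝ => log (q * exp x + 1)) (q * exp x / (q * exp x + 1)) x :=
      h1.log (by positivity)
    have h2 : HasDerivAt (fun x : ℝ => exp x + q) (exp x) x := by
      simpa using (Real.hasDerivAt_exp x).add_const q
    have h2' : HasDerivAt (fun x : ℝ => log (exp x + q)) (exp x / (exp x + q)) x :=
      h2.log (by positivity)
    exact (h0.sub h1').add h2'
  have hnonneg : ∀ x, 0 ≤ τ - q * exp x / (q * exp x + 1) + exp x / (exp x + q) := by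
    intro x
    have hu : 0 < exp x := exp_pos x
    have e : τ - q * exp x / (q * exp x + 1) + exp x / (exp x + q)
        = q * (q - 1) * (exp x - 1) ^ 2 / ((q + 1) * (q * exp x + 1) * (exp x + q)) := by
      rw [hτq]
      field_simp
      ring
    rw [e]
    exact div_nonneg (mul_nonneg (mul_nonneg hq0.le (by linarith)) (sq_nonneg _)) (by positivity)
  have hmono : Monotone g := monotone_of_hasDerivAt_nonneg hderiv fun x => hnonneg x
  have hg0 : g 0 = 0 := by simp [hg, add_comm]
  have hgd : 0 ≤ g (d / 2) := hg0 ▸ hmono (by linarith : (0 : ℝ) ≤ d / 2)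
  have hprod : exp ((d + Δ) / 2) = q * exp (d / 2) := by rw [hq, ← exp_add]; ring_nf
  have hpos1 : 0 < q * exp (d / 2) + 1 := by positivity
  have hpos2 : 0 < exp (d / 2) + q := by positivity
  rw [hprod, log_div hpos1.ne' hpos2.ne']
  have : g (d / 2) = τ * (d / 2) - log (q * exp (d / 2) + 1) + log (exp (d / 2) + q) := rfl
  linarith

/-! ## §1 Birkhoff's two-row inequality (`p, q, α` form) -/

/-- **BIRKHOFF's TWO-ROW INEQUALITY.**  Let `a, b` be positive rows on a finite set `s` with cross-ratios bounded by
`q²` (`a_k b_l ≤ q²·a_l b_k`, `q ≥ 1`), and `x > 0`, `y` vectors with `αx ≤ y ≤ p²·αx` on `s` (`α > 0`, `p ≥ 1`).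
Then `(Σ a y)(Σ b x)(p + q)² ≤ (Σ a x)(Σ b y)(pq + 1)²`.  (With `u = Σ a(y − αx)`, `v = Σ a(p²αx − y)` per row:
`(p²α − α)Σ a y = α(p²u + v)`, `(p²α − α)Σ a x = u + v`, the cross-ratio bound passes to `u_a v_b ≤ q² u_b v_a`, and
`four_var_le` concludes.) [folklore] (Birkhoff 1957; Eveson–Nussbaum 1995, Thm 3.5 p. 39) -/
theorem sum_mul_sum_le_birkhoff {ι : Type*} (s : Finset ι) {a b x y : ι → ℝ} {α p q : ℝ}
    (hp : 1 ≤ p) (hq : 1 ≤ q) (hα : 0 < α)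
    (ha : ∀ k ∈ s, 0 < a k) (hb : ∀ k ∈ s, 0 < b k) (hx : ∀ k ∈ s, 0 < x k)
    (hlo : ∀ k ∈ s, α * x k ≤ y k) (hhi : ∀ k ∈ s, y k ≤ p ^ 2 * (α * x k))
    (hcross : ∀ k ∈ s, ∀ l ∈ s, a k * b l ≤ q ^ 2 * (a l * b k)) :
    (∑ k ∈ s, a k * y k) * (∑ k ∈ s, b k * x k) * (p + q) ^ 2 ≤
      (∑ k ∈ s, a k * x k) * (∑ k ∈ s, b k * y k) * (p * q + 1) ^ 2 := by
  rcases s.eq_empty_or_nonempty with rfl | hne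
  · simp
  rcases eq_or_lt_of_le hp with rfl | hp1
  · -- `p = 1`: `y = αx` on `s`, both sides coincide
    have hy : ∀ k ∈ s, y k = α * x k := fun k hk => le_antisymm (by simpa using hhi k hk) (hlo k hk)
    have hay : ∑ k ∈ s, a k * y k = α * ∑ k ∈ s, a k * x k := by
      rw [Finset.mul_sum]; exact Finset.sum_congr rfl fun k hk => by rw [hy k hk]; ring
    have hby : ∑ k ∈ s, b k * y k = α * ∑ k ∈ s, b k * x k := by
      rw [Finset.mul_sum]; exact Finset.sum_congr rfl fun k hk => by rw [hy k hk]; ring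
    rw [hay, hby]
    exact le_of_eq (by ring)
  -- `p > 1`
  set β : ℝ := p ^ 2 * α with hβ
  set γ : ℝ := β - α with hγ
  have hγ0 : 0 < γ := by
    have : 1 < p ^ 2 := by nlinarith
    rw [hγ, hβ]; nlinarith
  set ua : ℝ := ∑ k ∈ s, a k * (y k - α * x k) with hua
  set va : ℝ := ∑ k ∈ s, a k * (β * x k - y k) with hva
  set ub : ℝ := ∑ k ∈ s, b k * (y k - α * x k) with hub
  set vb : ℝ := ∑ k ∈ s, b k * (β * x k - y k) with hvb
  have hlo' : ∀ k ∈ s, 0 ≤ y k - α * x k := fun k hk => sub_nonneg.2 (hlo k hk)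
  have hhi' : ∀ k ∈ s, 0 ≤ β * x k - y k := fun k hk => sub_nonneg.2 (by rw [hβ, mul_assoc]; exact hhi k hk)
  have hua0 : 0 ≤ ua := Finset.sum_nonneg fun k hk => mul_nonneg (ha k hk).le (hlo' k hk)
  have hva0 : 0 ≤ va := Finset.sum_nonneg fun k hk => mul_nonneg (ha k hk).le (hhi' k hk)
  have hub0 : 0 ≤ ub := Finset.sum_nonneg fun k hk => mul_nonneg (hb k hk).le (hlo' k hk)
  have hvb0 : 0 ≤ vb := Finset.sum_nonneg fun k hk => mul_nonneg (hb k hk).le (hhi' k hk)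
  -- the dictionary
  have hAy : γ * ∑ k ∈ s, a k * y k = α * (p ^ 2 * ua + va) := by
    simp only [hua, hva, Finset.mul_sum, ← Finset.sum_add_distrib]
    exact Finset.sum_congr rfl fun k _ => by rw [hγ, hβ]; ring
  have hAx : γ * ∑ k ∈ s, a k * x k = ua + va := by
    simp only [hua, hva, Finset.mul_sum, ← Finset.sum_add_distrib]
    exact Finset.sum_congr rfl fun k _ => by rw [hγ]; ring
  have hBy : γ * ∑ k ∈ s, b k * y k = α * (p ^ 2 * ub + vb) := by
    simp only [hub, hvb, Finset.mul_sum, ← Finset.sum_add_distrib]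
    exact Finset.sum_congr rfl fun k _ => by rw [hγ, hβ]; ring
  have hBx : γ * ∑ k ∈ s, b k * x k = ub + vb := by
    simp only [hub, hvb, Finset.mul_sum, ← Finset.sum_add_distrib]
    exact Finset.sum_congr rfl fun k _ => by rw [hγ]; ring
  -- the cross-ratio bound passes to `(u, v)`
  have hc : ua * vb ≤ q ^ 2 * (ub * va) := by
    rw [hua, hvb, hub, hva, Finset.sum_mul_sum, Finset.sum_mul_sum, Finset.mul_sum]
    refine Finset.sum_le_sum fun k hk => ?_
    rw [Finset.mul_sum]
    refine Finset.sum_le_sum fun l hl => ?_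
    have hw : 0 ≤ (y k - α * x k) * (β * x l - y l) := mul_nonneg (hlo' k hk) (hhi' l hl)
    calc a k * (y k - α * x k) * (b l * (β * x l - y l))
        = (a k * b l) * ((y k - α * x k) * (β * x l - y l)) := by ring
      _ ≤ (q ^ 2 * (a l * b k)) * ((y k - α * x k) * (β * x l - y l)) :=
          mul_le_mul_of_nonneg_right (hcross k hk l hl) hw
      _ = q ^ 2 * (b k * (y k - α * x k) * (a l * (β * x l - y l))) := by ring
  -- positivity of `ub + vb`
  have hbx : 0 < ∑ k ∈ s, b k * x k := Finset.sum_pos (fun k hk => mul_pos (hb k hk) (hx k hk)) hne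
  have hpos : 0 < ub + vb := by rw [← hBx]; exact mul_pos hγ0 hbx
  have h4 := four_var_le hp hq hua0 hva0 hub0 hpos hc
  -- undo the dictionary
  have key : γ ^ 2 * ((∑ k ∈ s, a k * y k) * (∑ k ∈ s, b k * x k) * (p + q) ^ 2) ≤
      γ ^ 2 * ((∑ k ∈ s, a k * x k) * (∑ k ∈ s, b k * y k) * (p * q + 1) ^ 2) := by
    calc γ ^ 2 * ((∑ k ∈ s, a k * y k) * (∑ k ∈ s, b k * x k) * (p + q) ^ 2)
          = (γ * ∑ k ∈ s, a k * y k) * (γ * ∑ k ∈ s, b k * x k) * (p + q) ^ 2 := by ring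
      _ = α * ((p ^ 2 * ua + va) * (ub + vb) * (p + q) ^ 2) := by rw [hAy, hBx]; ring
      _ ≤ α * ((ua + va) * (p ^ 2 * ub + vb) * (p * q + 1) ^ 2) := mul_le_mul_of_nonneg_left h4 hα.le
      _ = (γ * ∑ k ∈ s, a k * x k) * (γ * ∑ k ∈ s, b k * y k) * (p * q + 1) ^ 2 := by rw [hAx, hBy]; ring
      _ = γ ^ 2 * ((∑ k ∈ s, a k * x k) * (∑ k ∈ s, b k * y k) * (p * q + 1) ^ 2) := by ring
  exact le_of_mul_le_mul_left key (pow_pos hγ0 2)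

/-! ## §2 The exponential forms; the two weak bounds -/

section TwoRows

variable {ι : Type*} {s : Finset ι} {a b x y : ι → ℝ} {d Δ : ℝ}

/-- **BIRKHOFF's THEOREM, EXPONENTIAL FORM.**  Positive rows `a, b` on `s` with `a_k b_l ≤ e^Δ·a_l b_k` (projective
diameter of the pair of rows `≤ Δ`) and positive vectors with `y_k x_l ≤ e^d·x_k y_l` (Hilbert distance `≤ d`),
`d, Δ ≥ 0` ⇒ `(Σ a y)(Σ b x)(e^{d∕2} + e^{Δ∕2})² ≤ (Σ a x)(Σ b y)(e^{(d+Δ)∕2} + 1)²` — §1 with `α = min y∕x`,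
`p = e^{d∕2}`, `q = e^{Δ∕2}`. [folklore] (Birkhoff 1957; Eveson–Nussbaum 1995, Thm 3.5 p. 39) -/
theorem two_rows_le_birkhoff (hd : 0 ≤ d) (hΔ : 0 ≤ Δ)
    (ha : ∀ k ∈ s, 0 < a k) (hb : ∀ k ∈ s, 0 < b k) (hx : ∀ k ∈ s, 0 < x k) (hy : ∀ k ∈ s, 0 < y k)
    (hxy : ∀ k ∈ s, ∀ l ∈ s, y k * x l ≤ exp d * (x k * y l))
    (hab : ∀ k ∈ s, ∀ l ∈ s, a k * b l ≤ exp Δ * (a l * b k)) :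
    (∑ k ∈ s, a k * y k) * (∑ k ∈ s, b k * x k) * (exp (d / 2) + exp (Δ / 2)) ^ 2 ≤
      (∑ k ∈ s, a k * x k) * (∑ k ∈ s, b k * y k) * (exp ((d + Δ) / 2) + 1) ^ 2 := by
  rcases s.eq_empty_or_nonempty with rfl | hne
  · simp
  obtain ⟨k₀, hk₀, hmin⟩ := Finset.exists_min_image s (fun k => y k / x k) hne
  have hα0 : 0 < y k₀ / x k₀ := div_pos (hy k₀ hk₀) (hx k₀ hk₀)
  have hp : (1 : ℝ) ≤ exp (d / 2) := one_le_exp (by linarith)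
  have hq : (1 : ℝ) ≤ exp (Δ / 2) := one_le_exp (by linarith)
  have hp2 : exp (d / 2) ^ 2 = exp d := by rw [sq, ← exp_add]; ring_nf
  have hq2 : exp (Δ / 2) ^ 2 = exp Δ := by rw [sq, ← exp_add]; ring_nf
  have hpq : exp (d / 2) * exp (Δ / 2) = exp ((d + Δ) / 2) := by rw [← exp_add]; ring_nf
  have hlo : ∀ k ∈ s, y k₀ / x k₀ * x k ≤ y k := fun k hk => (le_div_iff₀ (hx k hk)).1 (hmin k hk)
  have hhi : ∀ k ∈ s, y k ≤ exp (d / 2) ^ 2 * (y k₀ / x k₀ * x k) := by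
    intro k hk
    rw [hp2]
    have h := hxy k hk k₀ hk₀
    have hx0 := hx k₀ hk₀
    calc y k = y k * x k₀ / x k₀ := by field_simp
      _ ≤ exp d * (x k * y k₀) / x k₀ := div_le_div_of_nonneg_right h hx0.le
      _ = exp d * (y k₀ / x k₀ * x k) := by field_simp
  have hab' : ∀ k ∈ s, ∀ l ∈ s, a k * b l ≤ exp (Δ / 2) ^ 2 * (a l * b k) := fun k hk l hl => by
    rw [hq2]; exact hab k hk l hl
  have h := sum_mul_sum_le_birkhoff s hp hq hα0 ha hb hx hlo hhi hab'
  rw [hpq] at h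
  exact h

/-- The same with Birkhoff's LINEAR coefficient folded in: `(Σ a y)(Σ b x) ≤ e^{tanh(Δ∕4)·d}·(Σ a x)(Σ b y)`.
[folklore] (Birkhoff 1957; Eveson–Nussbaum 1995, Thm 3.5 p. 39) -/
theorem two_rows_le_exp_tanh_mul (hd : 0 ≤ d) (hΔ : 0 ≤ Δ)
    (ha : ∀ k ∈ s, 0 < a k) (hb : ∀ k ∈ s, 0 < b k) (hx : ∀ k ∈ s, 0 < x k) (hy : ∀ k ∈ s, 0 < y k)
    (hxy : ∀ k ∈ s, ∀ l ∈ s, y k * x l ≤ exp d * (x k * y l))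
    (hab : ∀ k ∈ s, ∀ l ∈ s, a k * b l ≤ exp Δ * (a l * b k)) :
    (∑ k ∈ s, a k * y k) * (∑ k ∈ s, b k * x k) ≤
      exp (Real.tanh (Δ / 4) * d) * ((∑ k ∈ s, a k * x k) * (∑ k ∈ s, b k * y k)) := by
  rcases s.eq_empty_or_nonempty with rfl | hne
  · simp
  have h := two_rows_le_birkhoff hd hΔ ha hb hx hy hxy hab
  have hP : 0 < exp (d / 2) + exp (Δ / 2) := by positivity
  have hQ : 0 < exp ((d + Δ) / 2) + 1 := by positivity
  have hAx : 0 ≤ ∑ k ∈ s, a k * x k := sum_nonneg fun k hk => (mul_pos (ha k hk) (hx k hk)).le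
  have hBy : 0 ≤ ∑ k ∈ s, b k * y k := sum_nonneg fun k hk => (mul_pos (hb k hk) (hy k hk)).le
  have hZ : 0 < (exp ((d + Δ) / 2) + 1) / (exp (d / 2) + exp (Δ / 2)) := div_pos hQ hP
  have hexp : exp (2 * log ((exp ((d + Δ) / 2) + 1) / (exp (d / 2) + exp (Δ / 2))))
      = ((exp ((d + Δ) / 2) + 1) / (exp (d / 2) + exp (Δ / 2))) ^ 2 := by
    rw [show (2 : ℝ) * log ((exp ((d + Δ) / 2) + 1) / (exp (d / 2) + exp (Δ / 2)))
        = ((2 : ℕ) : ℝ) * log ((exp ((d + Δ) / 2) + 1) / (exp (d / 2) + exp (Δ / 2))) by norm_num,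
      ← log_pow, exp_log (pow_pos hZ 2)]
  calc (∑ k ∈ s, a k * y k) * (∑ k ∈ s, b k * x k)
      ≤ (∑ k ∈ s, a k * x k) * (∑ k ∈ s, b k * y k) * (exp ((d + Δ) / 2) + 1) ^ 2 / (exp (d / 2) + exp (Δ / 2)) ^ 2 :=
        (le_div_iff₀ (pow_pos hP 2)).2 h
    _ = ((exp ((d + Δ) / 2) + 1) / (exp (d / 2) + exp (Δ / 2))) ^ 2 * ((∑ k ∈ s, a k * x k) * (∑ k ∈ s, b k * y k)) := by
        rw [div_pow]; ring
    _ ≤ exp (Real.tanh (Δ / 4) * d) * ((∑ k ∈ s, a k * x k) * (∑ k ∈ s, b k * y k)) := by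
        rw [← hexp]
        exact mul_le_mul_of_nonneg_right (exp_le_exp.2 (two_mul_log_birkhoff_le_tanh_mul hd hΔ)) (mul_nonneg hAx hBy)

/-- **WEAK BOUND I — MONOTONICITY**: ANY two non-negative rows (no positivity, no cross-ratio bound) never expand the
distance: `(Σ a y)(Σ b x) ≤ e^d·(Σ a x)(Σ b y)`.  Birkhoff: a cone-preserving linear map is a weak contraction for
Hilbert's metric. [folklore] (Birkhoff 1957; Eveson–Nussbaum 1995, Thm 3.6 p. 39) -/
theorem two_rows_le_exp_dist (ha : ∀ k ∈ s, 0 ≤ a k) (hb : ∀ k ∈ s, 0 ≤ b k)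
    (hxy : ∀ k ∈ s, ∀ l ∈ s, y k * x l ≤ exp d * (x k * y l)) :
    (∑ k ∈ s, a k * y k) * (∑ k ∈ s, b k * x k) ≤ exp d * ((∑ k ∈ s, a k * x k) * (∑ k ∈ s, b k * y k)) := by
  rw [Finset.sum_mul_sum, Finset.sum_mul_sum, Finset.mul_sum]
  refine sum_le_sum fun k hk => ?_
  rw [Finset.mul_sum]
  refine sum_le_sum fun l hl => ?_
  calc a k * y k * (b l * x l) = (a k * b l) * (y k * x l) := by ring
    _ ≤ (a k * b l) * (exp d * (x k * y l)) :=
        mul_le_mul_of_nonneg_left (hxy k hk l hl) (mul_nonneg (ha k hk) (hb l hl))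
    _ = exp d * (a k * x k * (b l * y l)) := by ring

/-- **WEAK BOUND II — THE DIAMETER**: for ANY non-negative vectors (no distance hypothesis) the image distance is at
most the rows' projective diameter: `(Σ a y)(Σ b x) ≤ e^Δ·(Σ a x)(Σ b y)`. [folklore] -/
theorem two_rows_le_exp_diam (hx : ∀ k ∈ s, 0 ≤ x k) (hy : ∀ k ∈ s, 0 ≤ y k)
    (hab : ∀ k ∈ s, ∀ l ∈ s, a k * b l ≤ exp Δ * (a l * b k)) :
    (∑ k ∈ s, a k * y k) * (∑ k ∈ s, b k * x k) ≤ exp Δ * ((∑ k ∈ s, a k * x k) * (∑ k ∈ s, b k * y k)) := by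
  rw [Finset.sum_mul_sum, Finset.sum_mul_sum]
  rw [Finset.sum_comm (s := s) (t := s) (f := fun k l => a k * x k * (b l * y l)), Finset.mul_sum]
  refine sum_le_sum fun k hk => ?_
  rw [Finset.mul_sum]
  refine sum_le_sum fun l hl => ?_
  calc a k * y k * (b l * x l) = (a k * b l) * (y k * x l) := by ring
    _ ≤ (exp Δ * (a l * b k)) * (y k * x l) :=
        mul_le_mul_of_nonneg_right (hab k hk l hl) (mul_nonneg (hy k hk) (hx l hl))
    _ = exp Δ * (a l * x l * (b k * y k)) := by ring

end TwoRows

/-! ## §3 Iteration: a chain of kernels of diameter `≤ Δ` contracts geometrically -/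

/-- **GEOMETRIC CONTRACTION ALONG A CHAIN.**  Positive kernels `M j` on a finite index set `s`, each of projective
diameter `≤ Δ` (`M j σ k · M j σ′ l ≤ e^Δ · M j σ l · M j σ′ k`), applied to two positive vectors
(`x (j+1) = M j • x j`, `y (j+1) = M j • y j`) whose initial Hilbert distance is `≤ d`: after `n` steps the distance is
`≤ tanh(Δ∕4)^n · d` — `y n k · x n l ≤ exp (tanh(Δ∕4)^n·d) · x n k · y n l`. [folklore] (Birkhoff 1957; Eveson–Nussbaum 1995, Thm 3.5 p. 39) -/
theorem chain_dist_le_pow {ι : Type*} (s : Finset ι) (M : ℕ → ι → ι → ℝ) (x y : ℕ → ι → ℝ) {d Δ : ℝ}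
    (hd : 0 ≤ d) (hΔ : 0 ≤ Δ) (hM : ∀ j, ∀ σ ∈ s, ∀ k ∈ s, 0 < M j σ k)
    (hMM : ∀ j, ∀ σ ∈ s, ∀ σ' ∈ s, ∀ k ∈ s, ∀ l ∈ s, M j σ k * M j σ' l ≤ exp Δ * (M j σ l * M j σ' k))
    (hx0 : ∀ k ∈ s, 0 < x 0 k) (hy0 : ∀ k ∈ s, 0 < y 0 k)
    (hxs : ∀ j, ∀ σ ∈ s, x (j + 1) σ = ∑ k ∈ s, M j σ k * x j k)
    (hys : ∀ j, ∀ σ ∈ s, y (j + 1) σ = ∑ k ∈ s, M j σ k * y j k)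
    (h0 : ∀ k ∈ s, ∀ l ∈ s, y 0 k * x 0 l ≤ exp d * (x 0 k * y 0 l)) (n : ℕ) :
    ∀ k ∈ s, ∀ l ∈ s, y n k * x n l ≤ exp (Real.tanh (Δ / 4) ^ n * d) * (x n k * y n l) := by
  have main : ∀ n, (∀ k ∈ s, 0 < x n k) ∧ (∀ k ∈ s, 0 < y n k) ∧
      ∀ k ∈ s, ∀ l ∈ s, y n k * x n l ≤ exp (Real.tanh (Δ / 4) ^ n * d) * (x n k * y n l) := by
    intro n
    induction n with
    | zero => exact ⟨hx0, hy0, by simpa only [pow_zero, one_mul] using h0⟩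
    | succ n ih =>
      obtain ⟨hxn, hyn, hdn⟩ := ih
      have hdn0 : 0 ≤ Real.tanh (Δ / 4) ^ n * d := mul_nonneg (pow_nonneg (tanh_quarter_nonneg hΔ) n) hd
      refine ⟨fun σ hσ => ?_, fun σ hσ => ?_, fun σ hσ σ' hσ' => ?_⟩
      · rw [hxs n σ hσ]; exact sum_pos (fun k hk => mul_pos (hM n σ hσ k hk) (hxn k hk)) ⟨σ, hσ⟩
      · rw [hys n σ hσ]; exact sum_pos (fun k hk => mul_pos (hM n σ hσ k hk) (hyn k hk)) ⟨σ, hσ⟩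
      · have e : Real.tanh (Δ / 4) ^ (n + 1) * d = Real.tanh (Δ / 4) * (Real.tanh (Δ / 4) ^ n * d) := by ring
        rw [hys n σ hσ, hxs n σ' hσ', hxs n σ hσ, hys n σ' hσ', e]
        exact two_rows_le_exp_tanh_mul hdn0 hΔ (hM n σ hσ) (hM n σ' hσ') hxn hyn hdn
          (fun k hk l hl => hMM n σ hσ σ' hσ' k hk l hl)
  exact (main n).2.2

/-- The chain's rate is GEOMETRIC, hence SUMMABLE: `Σ_n tanh(Δ∕4)^n · d < ∞`. [folklore] -/
theorem summable_tanh_quarter_pow_mul {Δ : ℝ} (hΔ : 0 ≤ Δ) (d : ℝ) :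
    Summable fun n : ℕ => Real.tanh (Δ / 4) ^ n * d :=
  (summable_geometric_of_lt_one (tanh_quarter_nonneg hΔ) (tanh_quarter_lt_one Δ)).mul_right d

end Summit.QuantumFields.YangMills.BalabanUVNodes.N19BirkhoffContraction

end
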